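import Literature.AlgebraicGeometry.Frobenioids.IrreducibleMorphismsChainsConverse
import Literature.AlgebraicGeometry.Frobenioids.CategoriesFactorizationRevised
import Literature.AlgebraicGeometry.Frobenioids.IrreducibleArithmetic
import HarnessLib

/-!
# Frobenioids I, Proposition 1.14 (iii) in the author's revised form (Comments, 2024) — proved

Mochizuki, *The geometry of Frobenioids I: the general theory*, Kyushu J. Math. **62** (2008)
293–400, §1, Proposition 1.14 (iii), kurims text pp. 41–43 [cite: MochizukiFrdI2008, Prop. 1.14],
as REPLACED by the author's *Comments on "The geometry of Frobenioids I"* (January 2024), item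
(28), pp. 3–4 [cite: MochizukiFrdIComments2024, (28) pp.3-4]:

> "The statement of Proposition 1.14, (iii), should read as follows: Suppose that `φ` is
> irreducible. Then `φ` is a non-pre-step if and only if the following condition holds: If `φ`
> is an FSM-morphism, then there exists an `N ∈ ℕ_{≥1}` such that for every equality of
> composites in `C` `αₙ ∘ αₙ₋₁ ∘ ⋯ ∘ α₂ ∘ α₁ = ψ ∘ φ` — where `α₁` and `ψ` are irreducible
> morphisms, `n ∈ ℕ_{≥1}`, and `α₂, …, αₙ` are FSMI-morphisms [cf. §0] — it holds that `n ≤ N`."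

Standing data of Prop. 1.14: `Φ` a divisorial monoid on a connected, totally epimorphic category
`D`; `C → F_Φ` a Frobenioid (`hF`) of isotropic type (`hist`); `D` of FSMFF-type — here in the
author's REVISED sense `IsOfFSMFFType2024` (same item (28): condition (b) bounds the composites
`φₙ ∘ ⋯ ∘ φ₁` out of each object with `φ₁` ARBITRARY and `φ₂, …, φₙ` FSMI), typed in
`CategoriesFactorizationRevised.lean`.

EVERYTHING HERE IS PROVED (`not_isPreStep_iff_headedChains_bounded`, both implications), along
the author's replacement proof (comments p. 4):

* "⟸" (an irreducible pre-step violates the condition): an irreducible pre-step is an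
  FSM-morphism [(ii); Prop. 1.11 (vii)], so the condition demands a bound `N`; taking `ψ` to be a
  prime-Frobenius morphism of prime degree `p > N` [Def. 1.3 (ii); irreducible by Prop. 1.10
  (iv)], Prop. 1.10 (ii) rewrites `ψ ∘ φ = φ′ ∘ ψ′` with `ψ′` prime-Frobenius of degree `p` — the
  irreducible head `α₁` — and `φ′` a pre-step with zero divisor `p · ψ′_*(Div φ)`, a composite of
  `p` steps with irreducible zero divisor, i.e. of `p` FSMI-morphisms [(i), Prop. 1.11 (vii);
  Def. 1.3 (iii)(d)]: a composite of the required shape of length `p + 1 > N`. (In the 2008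
  text the head `α₁ = ψ′` had to be an FSMI-morphism, which prime-Frobenius morphisms need not
  be — the defect recorded in `IrreducibleMorphismsCounterexample.lean`; the revised text asks
  only that it be irreducible.)
* "⟹" (an irreducible non-pre-step satisfies the condition, with `N = N_D + 3`): `φ` is a
  prime-Frobenius or pull-back morphism, hence an isometry, and — being FSM — has bijective
  `φ^*`, so `Div(ψ ∘ φ) = φ^* Div(ψ)` is zero or irreducible and `deg_Fr(ψ ∘ φ)` divides a product
  of two primes. In `αₙ ∘ ⋯ ∘ α₁ = ψ ∘ φ` the FSMI tail `αₙ ∘ ⋯ ∘ α₂` has length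
  `m + Ω(deg) + k` (`chain_invariant` of `IrreducibleMorphismsChains.lean`: `m` pull-back factors
  projecting to a chain of `m` FSMI-morphisms of `D`, `Ω(deg) ≤ 2` prime-Frobenius factors, `k`
  steps), `k ≤ 1` because two steps would make `Div(ψ ∘ φ)` reducible whatever the irreducible
  head `α₁` is, and the projection `Base(αₙ ∘ ⋯ ∘ α₂) ∘ Base(α₁)` is a composite out of `A_D`
  with arbitrary head and FSMI tail of length `m + 1`, so `m + 1 ≤ N_D` by the REVISED condition
  (b) — uniformly in the codomain of `α₁`, which is exactly what the 2008 condition (b) does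
  not provide.

Also recorded: the witness against the 2008 text (the step `(id, 1, 1)` of the standard
Frobenioid, `IrreducibleMorphismsCounterexample.lean`) is classified correctly by the revised
statement (`StandardFrobenioidExample.revisedCondition_fails_stepOne`); and, for the cell's bookkeeping
(one named statement per printed item), the revised wording as the named proposition
`PreFrobenioid.NonPreStepIffBoundedFSMIChains2024` — the `…2024` twin of the 2008 record
`NonPreStepIffBoundedFSMIChains` — with its discharge `nonPreStepIffBoundedFSMIChains2024_holds`.
Renderings: composition is
diagrammatic (`φ ≫ ψ` is the text's `ψ ∘ φ`); "`αₙ ∘ ⋯ ∘ α₁ = ψ ∘ φ` with `α₁` irreducible and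
`α₂, …, αₙ` FSMI" is `IsHeadedFSMIChain (irreducible) (φ ≫ ψ) n`; "`N ∈ ℕ_{≥1}`" is rendered
`N : ℕ` (equivalent: enlarge `N`). No statement is strengthened or weakened.
-/

namespace Literature.AlgebraicGeometry.Frobenioids

open CategoryTheory Opposite ArithmeticFunction

universe w v v' u u'

/-! ### Monoid bookkeeping -/

section Monoid

variable {M N : Type w} [CommMonoid M] [CommMonoid N]

/-- A non-trivial reducible element stays non-trivial and reducible under an injective
homomorphism. [cite: MochizukiFrdI2008, §0 p.12] -/
theorem not_isIrreducibleElt_map_of_injective (f : M →* N) (hf : Function.Injective f) {a : M}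
    (ha : a ≠ 1) (hred : ¬ IsIrreducibleElt a) : f a ≠ 1 ∧ ¬ IsIrreducibleElt (f a) := by
  have h1 : ∀ x, f x = 1 ↔ x = 1 := fun x => map_eq_one_iff f hf
  refine ⟨fun h => ha ((h1 a).mp h), fun hirr => hred ⟨ha, fun b c hbc => ?_⟩⟩
  rcases hirr.2 (f b) (f c) (by rw [← map_mul, hbc]) with hb | hc
  · exact Or.inl ((h1 b).mp hb)
  · exact Or.inr ((h1 c).mp hc)

end Monoid

namespace PreFrobenioid

variable {D : Type u} [Category.{v} D] {Φ : Dᵒᵖ ⥤ CommMonCat.{w}}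
  {C : Type u'} [Category.{v'} C] (F : C ⥤ ElemFrobenioid Φ)

/-! ### Divisors and degrees of `ψ ∘ φ` for an irreducible non-pre-step `φ` -/

/-- An irreducible non-pre-step of a Frobenioid of isotropic type is a prime-Frobenius morphism
or a pull-back morphism [(i)]; in particular it is an isometry.
[cite: MochizukiFrdIComments2024, (28) p.4] -/
theorem isPrimeFrobenius_or_isPullbackMorphism_of_not_isPreStep (hF : IsFrobenioid F)
    (hist : IsOfIsotropicType F) {A B : C} {φ : A ⟶ B} (hirr : IsIrreducibleHom φ)
    (hnps : ¬ IsPreStep F φ) :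
    (IsPrimeFrobenius F φ ∨ IsPullbackMorphism F φ) ∧ IsIsometry F φ := by
  rcases trichotomy_of_isIrreducibleHom F hF hist hirr with ha | ⟨hb, -⟩ | ⟨hc, -⟩
  · exact ⟨Or.inl ha, ha.1.1.2⟩
  · exact (hnps hb.1).elim
  · exact ⟨Or.inr hc, (hF.iv_b φ hc).1.2⟩

/-- For an irreducible non-pre-step `φ` which is an FSM-morphism, `φ^*` is bijective (`Base(φ)`
is an isomorphism, or — for a pull-back morphism — an FSM-morphism of `D`, Prop. 1.11 (vi), along
which a monoid on `D` pulls back bijectively). [cite: MochizukiFrdIComments2024, (28) p.4] -/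
theorem pull_bijective_of_not_isPreStep (hF : IsFrobenioid F) (hist : IsOfIsotropicType F)
    {A B : C} {φ : A ⟶ B} (hirr : IsIrreducibleHom φ) (hnps : ¬ IsPreStep F φ) (hfsm : IsFSM φ) :
    Function.Bijective (pull Φ (Base F φ)) := by
  rcases (isPrimeFrobenius_or_isPullbackMorphism_of_not_isPreStep F hF hist hirr hnps).1 with ha | hc
  · haveI : IsIso (Base F φ) := ha.1.2
    exact ⟨pull_injective_of_isIso Φ (Base F φ),
      fun y => ⟨pull Φ (inv (Base F φ)) y, pull_pull_inv Φ (Base F φ) y⟩⟩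
  · exact hF.isPreFrobenioid.isMonoidOn.bijective_of_isFSM _
      ((isFSM_iff_of_isPullbackMorphism hF hc).mp hfsm)

/-- "Since `φ` is an isometry, it follows from the fact that `ψ` is irreducible that `Div(ψ ∘ φ)`
is either zero or irreducible" (comments p. 4) — for `φ` an irreducible non-pre-step which is an
FSM-morphism. [cite: MochizukiFrdIComments2024, (28) p.4] -/
theorem div_comp_eq_one_or_isIrreducibleElt (hF : IsFrobenioid F) (hist : IsOfIsotropicType F)
    {A B B' : C} {φ : A ⟶ B} (hirr : IsIrreducibleHom φ) (hnps : ¬ IsPreStep F φ) (hfsm : IsFSM φ)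
    {ψ : B ⟶ B'} (hψ : IsIrreducibleHom ψ) :
    Div F (φ ≫ ψ) = 1 ∨ IsIrreducibleElt (Div F (φ ≫ ψ)) := by
  have hφi := (isPrimeFrobenius_or_isPullbackMorphism_of_not_isPreStep F hF hist hirr hnps).2
  have hd : Div F (φ ≫ ψ) = pull Φ (Base F φ) (Div F ψ) := by
    rw [div_comp, show Div F φ = 1 from hφi, one_pow, mul_one]
  rcases trichotomy_of_isIrreducibleHom F hF hist hψ with ha | ⟨-, hbirr⟩ | ⟨hc, -⟩
  · exact Or.inl (by rw [hd, show Div F ψ = 1 from ha.1.1.2, map_one])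
  · exact Or.inr (by
      rw [hd]
      exact (isIrreducibleElt_map_iff _
        (pull_bijective_of_not_isPreStep F hF hist hirr hnps hfsm) _).mpr hbirr)
  · exact Or.inl (by rw [hd, show Div F ψ = 1 from (hF.iv_b ψ hc).1.2, map_one])

/-- The Frobenius degree of an irreducible morphism has at most one prime factor [(i): prime for
a prime-Frobenius morphism, `1` for steps and pull-back morphisms].
[cite: MochizukiFrdIComments2024, (28) p.4] -/
theorem cardFactors_degFr_le_one_of_isIrreducibleHom (hF : IsFrobenioid F)
    (hist : IsOfIsotropicType F) {A B : C} {φ : A ⟶ B} (hirr : IsIrreducibleHom φ) :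
    cardFactors (degFr F φ : ℕ) ≤ 1 := by
  rcases trichotomy_of_isIrreducibleHom F hF hist hirr with ha | ⟨hb, -⟩ | ⟨hc, -⟩
  · rw [cardFactors_apply_prime ha.2]
  · rw [show degFr F φ = 1 from hb.1.1, PNat.one_coe, cardFactors_one]
    exact Nat.zero_le _
  · rw [show degFr F φ = 1 from (hF.iv_b φ hc).2, PNat.one_coe, cardFactors_one]
    exact Nat.zero_le _

/-- "`deg_Fr(ψ ∘ φ)` always divides a product of two prime numbers [the irreducibility of `φ`,
`ψ`]" (comments p. 4): it has at most two prime factors. [cite: MochizukiFrdIComments2024, (28) p.4] -/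
theorem cardFactors_degFr_comp_le_two (hF : IsFrobenioid F) (hist : IsOfIsotropicType F)
    {A B B' : C} {φ : A ⟶ B} {ψ : B ⟶ B'} (hirr : IsIrreducibleHom φ) (hψ : IsIrreducibleHom ψ) :
    cardFactors (degFr F (φ ≫ ψ) : ℕ) ≤ 2 := by
  have h1 := cardFactors_degFr_le_one_of_isIrreducibleHom F hF hist hirr
  have h2 := cardFactors_degFr_le_one_of_isIrreducibleHom F hF hist hψ
  rw [degFr_comp, PNat.mul_coe, cardFactors_mul (PNat.ne_zero _) (PNat.ne_zero _)]
  omega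

/-! ### The head of a composite: a non-trivial reducible tail divisor stays so -/

/-- If `χ` has a non-trivial, reducible zero divisor and `α₁` is irreducible, then `χ ∘ α₁` has a
non-trivial, reducible zero divisor: for an isometric head [(a), (c) of (i)]
`Div(χ ∘ α₁) = α₁^* Div(χ)` with `α₁^*` injective; for a step [(b)] one more non-trivial summand
`Div(α₁)` is added (Remark 1.1.1; monoid bookkeeping from `IrreducibleArithmetic.lean`).
[cite: MochizukiFrdIComments2024, (28) p.4] -/
theorem div_comp_reducible_of_isIrreducibleHom_head (hF : IsFrobenioid F)
    (hist : IsOfIsotropicType F) {A X B' : C} {α₁ : A ⟶ X} {χ : X ⟶ B'}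
    (hα₁ : IsIrreducibleHom α₁) (hne : Div F χ ≠ 1) (hred : ¬ IsIrreducibleElt (Div F χ)) :
    Div F (α₁ ≫ χ) ≠ 1 ∧ ¬ IsIrreducibleElt (Div F (α₁ ≫ χ)) := by
  have hP : IsPreFrobenioid Φ F := hF.isPreFrobenioid
  have hinj : Function.Injective (pull Φ (Base F α₁)) := (hP.isMonoidOn.isCharInjective _).1
  have ht := not_isIrreducibleElt_map_of_injective (pull Φ (Base F α₁)) hinj hne hred
  rw [div_comp]
  rcases trichotomy_of_isIrreducibleHom F hF hist hα₁ with ha | ⟨hb, hbirr⟩ | ⟨hc, -⟩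
  · rwa [show Div F α₁ = 1 from ha.1.1.2, one_pow, mul_one]
  · have hsharp := (hP.isDivisorial (baseObj F A)).isSharp
    have hpow : Div F α₁ ^ (degFr F χ : ℕ) ≠ 1 := pow_ne_one_of_ne_one hsharp hbirr.1 (PNat.ne_zero _)
    exact ⟨fun h => ht.1 (hsharp.eq_one_of_isUnit _ (IsUnit.of_mul_eq_one _ h)),
      not_isIrreducibleElt_mul ht.1 hpow⟩
  · rwa [show Div F α₁ = 1 from (hF.iv_b α₁ hc).1.2, one_pow, mul_one]

/-! ### Proposition 1.14 (iii), revised statement: both implications -/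

/-- **Prop. 1.14 (iii) [revised], "⟸"**: an irreducible PRE-STEP violates the condition — it is
an FSM-morphism, and for a prime-Frobenius `ψ` of prime degree `p` the composite `ψ ∘ φ`
rewrites [Prop. 1.10 (ii)] as `φ′ ∘ ψ′` with irreducible head `ψ′` (prime-Frobenius of degree `p`)
followed by `p` FSMI-morphisms (steps with irreducible zero divisor, Def. 1.3 (iii)(d)), a
composite of the shape in question of length `p + 1`, unbounded in `p`.
[cite: MochizukiFrdIComments2024, (28) p.4] -/
theorem exists_long_headedChain_of_isPreStep (hF : IsFrobenioid F) (hist : IsOfIsotropicType F)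
    {A B : C} {φ : A ⟶ B} (hirr : IsIrreducibleHom φ) (hps : IsPreStep F φ) (N : ℕ) :
    ∃ (B' : C) (ψ : B ⟶ B') (n : ℕ), IsIrreducibleHom ψ ∧
      IsHeadedFSMIChain (fun _ _ f => IsIrreducibleHom f) (φ ≫ ψ) n ∧ N < n := by
  -- `Div(φ)` is irreducible [(i)]
  have hx := isIrreducibleElt_div_of_isIrreducibleHom F hF hist hps hirr
  -- a prime `p > N` and a prime-Frobenius `ψ : B → B'` of degree `p` [Def. 1.3 (ii)]
  obtain ⟨p, hNp, hp⟩ := Nat.exists_infinite_primes (N + 1)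
  obtain ⟨B', ψ, hψ, hψd⟩ := hF.ii_exists B ⟨p, hp.pos⟩
  have hψpf : IsPrimeFrobenius F ψ := ⟨hψ, by rw [hψd]; exact hp⟩
  -- Prop. 1.10 (ii): `ψ ∘ φ = φ' ∘ ψ'`, `ψ'` prime-Frobenius of degree `p`, `φ'` a pre-step
  obtain ⟨A', ψ', φ', hψ', hφ', hsw, hdeg', hdiv'⟩ :=
    exists_frobeniusType_preStep_swap hF φ hps ψ hψ
  haveI : IsIso (Base F ψ') := hψ'.2
  have hψ'pf : IsPrimeFrobenius F ψ' := ⟨hψ', by rw [hdeg', hψd]; exact hp⟩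
  -- `Div(φ') = (ψ'_* Div φ) ^ p` with `ψ'_* Div φ` irreducible: `φ'` is a chain of `p` FSMI-morphisms
  have hbij : Function.Bijective (pull Φ (inv (Base F ψ'))) :=
    ⟨pull_injective_of_isIso Φ _, fun y => ⟨pull Φ (inv (inv (Base F ψ'))) y, pull_pull_inv Φ _ y⟩⟩
  have hz : IsIrreducibleElt (pull Φ (inv (Base F ψ')) (Div F φ)) :=
    (isIrreducibleElt_map_iff _ hbij _).mpr hx
  obtain ⟨k, hk⟩ : ∃ k, p = k + 1 := ⟨p - 1, (Nat.sub_add_cancel hp.pos).symm⟩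
  have hchain : IsFSMIChain φ' (k + 1) := by
    refine isFSMIChain_of_div_eq_pow F hF hist k φ' _ hz hφ' ?_
    rw [hdiv', hψd, ← hk]
    rfl
  refine ⟨B', ψ, k + 1 + 1, hψpf.isIrreducibleHom hF (hist B), ?_, by omega⟩
  rw [← hsw]
  exact IsHeadedFSMIChain.comp ψ' φ' (k + 1) (hψ'pf.isIrreducibleHom hF (hist A)) hchain

/-- **Prop. 1.14 (iii) [revised], "⟹"**: for an irreducible NON-pre-step `φ : A → B` which is an
FSM-morphism, over a base category of FSMFF-type in the revised sense with bound `N_D` at `A_D`,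
every equality `αₙ ∘ ⋯ ∘ α₁ = ψ ∘ φ` with `α₁`, `ψ` irreducible and `α₂, …, αₙ` FSMI has
`n ≤ N_D + 3` (comments p. 4: at most two prime-Frobenius factors, at most one step, and the
pull-back factors project to a composite out of `A_D` with arbitrary head and FSMI tail).
[cite: MochizukiFrdIComments2024, (28) p.4] -/
theorem headedChain_le_of_not_isPreStep (hF : IsFrobenioid F) (hist : IsOfIsotropicType F)
    {A B : C} {φ : A ⟶ B} (hirr : IsIrreducibleHom φ) (hnps : ¬ IsPreStep F φ) (hfsm : IsFSM φ)
    {N : ℕ} (hN : ∀ {Y : D} (f : baseObj F A ⟶ Y) (n : ℕ), IsHeadedFSMIChain ⊤ f n → n ≤ N)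
    {B' : C} {ψ : B ⟶ B'} (hψ : IsIrreducibleHom ψ) {n : ℕ}
    (hch : IsHeadedFSMIChain (fun _ _ f => IsIrreducibleHom f) (φ ≫ ψ) n) : n ≤ N + 3 := by
  obtain ⟨X, α₁, χ, hα₁, hfac, hcase⟩ := hch.exists_fac
  rcases hcase with ⟨rfl, -⟩ | ⟨m, rfl, hχ⟩
  · omega
  -- the FSMI tail `χ` has length `m = m' + Ω(deg χ) + k`
  obtain ⟨m', k, hm, hbase, -, h1, h2⟩ := chain_invariant F hF hist hχ
  -- (1) the projection to `D`: a composite out of `A_D` with head `Base(α₁)` and FSMI tail of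
  -- length `m'`, so `m' + 1 ≤ N`
  have hm' : m' + 1 ≤ N :=
    hN (Base F α₁ ≫ Base F χ) (m' + 1)
      (IsHeadedFSMIChain.comp_of_isIso_or_chain (P := ⊤)
        (fun f e _ _ => MorphismProperty.top_apply _) (Base F α₁) (Base F χ)
        (MorphismProperty.top_apply _) hbase)
  -- (2) the Frobenius degree: `Ω(deg χ) ≤ Ω(deg(ψ ∘ φ)) ≤ 2`
  have hΩ : cardFactors (degFr F χ : ℕ) ≤ 2 := by
    have hd : cardFactors (degFr F (α₁ ≫ χ) : ℕ) ≤ 2 := by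
      rw [hfac]
      exact cardFactors_degFr_comp_le_two F hF hist hirr hψ
    rw [degFr_comp, PNat.mul_coe, cardFactors_mul (PNat.ne_zero _) (PNat.ne_zero _)] at hd
    omega
  -- (3) the zero divisor: at most one step in the tail
  have hk : k ≤ 1 := by
    by_contra hk
    have hbad := div_comp_reducible_of_isIrreducibleHom_head F hF hist hα₁ (h1 (by omega))
      (h2 (by omega))
    rw [hfac] at hbad
    rcases div_comp_eq_one_or_isIrreducibleElt F hF hist hirr hnps hfsm hψ with h0 | hi
    · exact hbad.1 h0
    · exact hbad.2 hi
  omega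

/-- **Prop. 1.14 (iii), as revised by the author (Comments (28), 2024)**: in a Frobenioid of
isotropic type over a base category of FSMFF-type [revised sense], an irreducible morphism `φ` is
a non-pre-step if and only if: "If `φ` is an FSM-morphism, then there exists an `N` such that for
every equality of composites `αₙ ∘ ⋯ ∘ α₂ ∘ α₁ = ψ ∘ φ` — where `α₁` and `ψ` are irreducible
morphisms, `n ≥ 1`, and `α₂, …, αₙ` are FSMI-morphisms — it holds that `n ≤ N`."
[cite: MochizukiFrdIComments2024, (28) pp.3-4] -/
theorem not_isPreStep_iff_headedChains_bounded (hF : IsFrobenioid F) (hist : IsOfIsotropicType F)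
    (hD : IsOfFSMFFType2024 D) {A B : C} {φ : A ⟶ B} (hirr : IsIrreducibleHom φ) :
    ¬ IsPreStep F φ ↔
      (IsFSM φ → ∃ N : ℕ, ∀ ⦃B' : C⦄ (ψ : B ⟶ B') (n : ℕ), IsIrreducibleHom ψ →
        IsHeadedFSMIChain (fun _ _ f => IsIrreducibleHom f) (φ ≫ ψ) n → n ≤ N) := by
  constructor
  · intro hnps hfsm
    obtain ⟨N, hN⟩ := hD.bounded (baseObj F A)
    exact ⟨N + 3, fun B' ψ n hψ hch =>
      headedChain_le_of_not_isPreStep F hF hist hirr hnps hfsm hN hψ hch⟩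
  · intro hcond hps
    have hfsm : IsFSM φ :=
      IsCoAngularPreStep.isFSM hF ⟨isCoAngular_of_isOfIsotropicType F hist φ, hps⟩
    obtain ⟨N, hN⟩ := hcond hfsm
    obtain ⟨B', ψ, n, hψ, hch, hlt⟩ := exists_long_headedChain_of_isPreStep F hF hist hirr hps N
    exact absurd (hN ψ n hψ hch) (by omega)

/-- The revised Prop. 1.14 (iii) with the bound made explicit and uniform: `N = N_D + 3`, where
`N_D` is the bound of the revised condition (b) at `A_D` — in particular independent of `φ` among
the irreducible non-pre-steps out of `A`. [cite: MochizukiFrdIComments2024, (28) p.4] -/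
theorem exists_uniform_headedChain_bound (hF : IsFrobenioid F) (hist : IsOfIsotropicType F)
    (hD : IsOfFSMFFType2024 D) (A : C) :
    ∃ N : ℕ, ∀ ⦃B : C⦄ (φ : A ⟶ B), IsIrreducibleHom φ → ¬ IsPreStep F φ → IsFSM φ →
      ∀ ⦃B' : C⦄ (ψ : B ⟶ B') (n : ℕ), IsIrreducibleHom ψ →
        IsHeadedFSMIChain (fun _ _ f => IsIrreducibleHom f) (φ ≫ ψ) n → n ≤ N := by
  obtain ⟨N, hN⟩ := hD.bounded (baseObj F A)
  exact ⟨N + 3, fun B φ hirr hnps hfsm B' ψ n hψ hch =>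
    headedChain_le_of_not_isPreStep F hF hist hirr hnps hfsm hN hψ hch⟩

end PreFrobenioid

/-! ### The 2008 witness is classified correctly by the revised statement -/

namespace StandardFrobenioidExample

/-- The one-morphism base category of the standard Frobenioid is of FSM-type, hence of
FSMFF-type in the revised sense. [cite: MochizukiFrdI2008, §0 p.18] -/
theorem isOfFSMFFType2024_D : IsOfFSMFFType2024 D :=
  (IsOfFSMType.mk fun f _ => isIso_D f).isOfFSMFFType2024

/-- For the irreducible pre-step `(id, 1, 1)` of the standard Frobenioid — the witness against the
2008 wording of Prop. 1.14 (iii) (`not_NonPreStepIffBoundedFSMIChains`) — the REVISED condition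
fails, as the revised statement predicts for a pre-step. [cite: MochizukiFrdIComments2024, (28) pp.3-4] -/
theorem revisedCondition_fails_stepOne :
    ¬ (IsFSM (stepOne A) → ∃ N : ℕ, ∀ ⦃Y : ElemFrobenioid Φst⦄ (ψ : A ⟶ Y) (n : ℕ),
        IsIrreducibleHom ψ → IsHeadedFSMIChain (fun _ _ f => IsIrreducibleHom f) (stepOne A ≫ ψ) n →
          n ≤ N) := fun h =>
  (PreFrobenioid.not_isPreStep_iff_headedChains_bounded (ElemFrobenioid.toChar Φst) isFrobenioid
    isOfIsotropicType isOfFSMFFType2024_D (isIrreducibleHom_stepOne A)).mpr h (isPreStep_stepOne A)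

end StandardFrobenioidExample

/-! ### The revised statement as a named proposition -/

namespace PreFrobenioid

/-- **Prop. 1.14 (iii) in the author's revised (2024) wording, as a named statement** — the
`…2024` twin of the 2008 record `NonPreStepIffBoundedFSMIChains` of
`IrreducibleMorphismsCounterexample.lean` (which is FALSE AS TYPED, kernel witness
`StandardFrobenioidExample.not_NonPreStepIffBoundedFSMIChains`; the 2008 printed text of (iii), like
the 2008 condition (b) of "FSMFF-type" in §0, is thereby recorded as an erratum acknowledged and
replaced by the author in Comments (28)). For a Frobenioid `C → F_Φ` of isotropic type over a base
category of FSMFF-type in the revised sense (`IsOfFSMFFType2024`): "Suppose that `φ` is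
irreducible. Then `φ` is a non-pre-step if and only if the following condition holds: If `φ` is an
FSM-morphism, then there exists an `N ∈ ℕ_{≥1}` such that for every equality of composites in `C`
`αₙ ∘ αₙ₋₁ ∘ ⋯ ∘ α₂ ∘ α₁ = ψ ∘ φ` — where `α₁` and `ψ` are irreducible morphisms, `n ∈ ℕ_{≥1}`, and
`α₂, …, αₙ` are FSMI-morphisms [cf. §0] — it holds that `n ≤ N`." PROVED:
`nonPreStepIffBoundedFSMIChains2024_holds`. [cite: MochizukiFrdI2008, Prop. 1.14(iii) p.41]
[cite: MochizukiFrdIComments2024, (28) pp.3-4] -/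
def NonPreStepIffBoundedFSMIChains2024 : Prop :=
  ∀ {D : Type u} [Category.{v} D] {Φ : Dᵒᵖ ⥤ CommMonCat.{w}} {C : Type u'} [Category.{v'} C]
    (F : C ⥤ ElemFrobenioid Φ), IsFrobenioid F → IsOfIsotropicType F → IsOfFSMFFType2024 D →
    ∀ {A B : C} (φ : A ⟶ B), IsIrreducibleHom φ →
      (¬ IsPreStep F φ ↔
        (IsFSM φ → ∃ N : ℕ, ∀ ⦃B' : C⦄ (ψ : B ⟶ B') (n : ℕ), IsIrreducibleHom ψ →
          IsHeadedFSMIChain (fun _ _ f => IsIrreducibleHom f) (φ ≫ ψ) n → n ≤ N))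

/-- The named statement `NonPreStepIffBoundedFSMIChains2024` (Prop. 1.14 (iii) as revised by the
author) HOLDS — by `not_isPreStep_iff_headedChains_bounded`.
[cite: MochizukiFrdIComments2024, (28) pp.3-4] -/
theorem nonPreStepIffBoundedFSMIChains2024_holds :
    NonPreStepIffBoundedFSMIChains2024.{w, v, v', u, u'} := by
  intro D _ Φ C _ F hF hist hD A B φ hirr
  exact not_isPreStep_iff_headedChains_bounded F hF hist hD hirr

/-- `NonPreStepIffBoundedFSMIChains2024` — `_holds` alias of `nonPreStepIffBoundedFSMIChains2024_holds` above under the fact's exact name (appended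
2026-08-28, D-0026 bookkeeping: the proof term is the existing theorem of this file; no statement,
definition or attribute is edited; no new named fact; the ledger's debt table listed the fact
unproved). [cite: MochizukiFrdIComments2024, (28) pp.3-4] -/
theorem _root_.Literature.AlgebraicGeometry.Frobenioids.PreFrobenioid.NonPreStepIffBoundedFSMIChains2024_holds :
    NonPreStepIffBoundedFSMIChains2024.{w, v, v', u, u'} :=
  _root_.Literature.AlgebraicGeometry.Frobenioids.PreFrobenioid.nonPreStepIffBoundedFSMIChains2024_holds

end PreFrobenioid

end Literature.AlgebraicGeometry.Frobenioids
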